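import Summits.CriticalPhenomena.PercolationContinuityZ3.Theorems.PercNearOneGluingNoHeavyLowerTailSunflowerMinorInduction
import HarnessLib
import HarnessLib.Audit

/-!
# `NoHeavyLowerTail` (crux stmt-CriticalPhenomena-4575), abstract sunflower cubic: CUBE SUPERADDITIVITY of the Gladkov slack under
# deletion–contraction, and the first proved case of `MinorSuperadditivity` (DC) — the contracted element is dominant

Support file (seat `prim-l12-p2` gen 20; `--supports stmt-CriticalPhenomena-4575`).  No `sorry`, no new definitions.
Memo: run/shared/lean/prim/prim-l12/prim-l12-p2/FINDING-g20-COMPLEMENT-READING.md §8(c),(d).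

Notation of `…SunflowerMinorInduction`: in the minor `(W;C)` the cube `U ⊆ W` has `minorAB C U` kernel–bottom pairs and `minorCR C U` cross pairs;
its Gladkov slack is `minorAB − minorCR`.  For `x ∉ U`, `x ∉ C` the cube `U ∪ {x}` of `(·;C)` ("`F`"), the cube `U` of `(·;C)` ("deletion `d`")
and the cube `U` of `(·;C ∪ {x})` ("contraction `c`", labels `T ↦ lab (T ∪ C ∪ {x})`) are related by

* `Sunflower.minorCube_superadditive` — **CUBE SUPERADDITIVITY** (memo §8(c)):
  `gl_F(U ∪ {x}) ≥ gl_d(U) + gl_c(U)`.  Proof: expand the three slacks as sums over `T ⊆ U` of indicators in the four labels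
  `(d T, c T, d (U∖T), c (U∖T))`; the summand `g(T)` of `gl_d + gl_c − gl_F` satisfies `g(T) + g(U∖T) ≤ 0` for every label pattern allowed
  by monotonicity (`d ≤ c` in `M₃`; a finite check, `decide`) — the combinatorial content is that the two mixed cross-pair types inject
  disjointly into the mixed kernel–bottom pairs (swap the sides).
* `Sunflower.minorSuperadditivity_of_dominant` — **(DC) AT A DOMINANT ELEMENT**: if `lab (C ∪ {x}) = 4` then
  `f(W∖x; C) + f(W∖x; C ∪ {x}) ≤ f(W; C)` (the contraction has neither bottoms nor rainbows, the top minor has no rainbows, and cube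
  superadditivity compares the slacks).  So the typed conjecture `MinorSuperadditivity` holds at every dominant element; the memo records
  that at a FREE element it is exactly (★_B) for the deletion, and the general case is open (census: exhaustive n ≤ 5).
-/

namespace Summit.CriticalPhenomena.PercolationContinuityZ3.Theorems.SunflowerPartition

open Finset

namespace Sunflower

variable {α : Type*} [Fintype α] [DecidableEq α] (F : Sunflower α)

/-! ## Indicator expansions of the cube counts -/

omit [Fintype α] in
/-- `minorAB` as an indicator sum. [this work] -/
theorem minorAB_eq_sum (C U : Finset α) :
    (F.minorAB C U : ℤ) = ∑ O ∈ U.powerset, (if F.lab (O ∪ C) = 0 ∧ F.lab ((U \ O) ∪ C) = 4 then (1 : ℤ) else 0) := by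
  unfold minorAB
  rw [Finset.sum_boole]

omit [Fintype α] in
/-- `minorCR` as an indicator sum. [this work] -/
theorem minorCR_eq_sum (C U : Finset α) :
    (F.minorCR C U : ℤ) = ∑ Y ∈ U.powerset, (if F.lab (Y ∪ C) ≠ 0 ∧ F.lab (Y ∪ C) ≠ 4 ∧ F.lab ((U \ Y) ∪ C) ≠ 0 ∧
      F.lab ((U \ Y) ∪ C) ≠ 4 ∧ F.lab ((U \ Y) ∪ C) < F.lab (Y ∪ C) then (1 : ℤ) else 0) := by
  unfold minorCR
  rw [Finset.sum_boole]

/-! ## The pointwise inequality (finite check in the four labels) -/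

omit [Fintype α] in
/-- The `M₃` order on labels: `a ≤ b` iff `a = b ∨ a = 0 ∨ b = 4`. [this work] -/
theorem lab_union_le (T C : Finset α) (x : α) :
    F.lab (T ∪ C) = F.lab (T ∪ insert x C) ∨ F.lab (T ∪ C) = 0 ∨ F.lab (T ∪ insert x C) = 4 := by
  have hsub : T ∪ C ⊆ T ∪ insert x C := union_subset_union (subset_refl _) (subset_insert _ _)
  rcases F.lab_mono hsub with h | h | h
  · exact Or.inl h
  · exact Or.inr (Or.inl h)
  · exact Or.inr (Or.inr h)

/-- The summand `g(a,b,a',b')` of `gl_d + gl_c − gl_F` at a set `T ⊆ U` with labels `a = d T`, `b = c T`, `a' = d (U∖T)`, `b' = c (U∖T)`: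
the cross-pair indicators of `F` (two, `x` on either side) minus those of `d` and `c`, minus the kernel–bottom indicators of `F` plus those
of `d` and `c`. [this work] -/
def cubeG (a b a' b' : Fin 5) : ℤ :=
  (if b' ≠ 0 ∧ b' ≠ 4 ∧ a ≠ 0 ∧ a ≠ 4 ∧ b' < a then 1 else 0) + (if a' ≠ 0 ∧ a' ≠ 4 ∧ b ≠ 0 ∧ b ≠ 4 ∧ a' < b then 1 else 0)
  - (if a' ≠ 0 ∧ a' ≠ 4 ∧ a ≠ 0 ∧ a ≠ 4 ∧ a' < a then 1 else 0) - (if b' ≠ 0 ∧ b' ≠ 4 ∧ b ≠ 0 ∧ b ≠ 4 ∧ b' < b then 1 else 0)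
  - (if a = 0 ∧ b' = 4 then 1 else 0) - (if b = 0 ∧ a' = 4 then 1 else 0)
  + (if a = 0 ∧ a' = 4 then 1 else 0) + (if b = 0 ∧ b' = 4 then 1 else 0)

/-- **The pointwise bound**: `g(T) + g(U∖T) ≤ 0` for every label pattern with `d ≤ c` on both sides. [this work] -/
theorem cubeG_symm_nonpos : ∀ a b a' b' : Fin 5,
    (a = b ∨ a = 0 ∨ b = 4) → (a' = b' ∨ a' = 0 ∨ b' = 4) → cubeG a b a' b' + cubeG a' b' a b ≤ 0 := by
  unfold cubeG; decide

/-! ## Cube superadditivity -/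

omit [Fintype α] in
/-- **CUBE SUPERADDITIVITY** (this work; memo §8(c)): for `x ∉ U`, the Gladkov slack of the cube `U ∪ {x}` in the minor `(·;C)`
is at least the sum of the slacks of the cube `U` in `(·;C)` (deletion of `x`) and in `(·;C ∪ {x})` (contraction of `x`). [this work] -/
theorem minorCube_superadditive (C U : Finset α) (x : α) (hxU : x ∉ U) :
    ((F.minorAB C U : ℤ) - F.minorCR C U) + ((F.minorAB (insert x C) U : ℤ) - F.minorCR (insert x C) U)
      ≤ (F.minorAB C (insert x U) : ℤ) - F.minorCR C (insert x U) := by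
  -- the four label functions
  set d : Finset α → Fin 5 := fun T => F.lab (T ∪ C) with hd
  set c : Finset α → Fin 5 := fun T => F.lab (T ∪ insert x C) with hc
  -- set identities for `T ⊆ U`
  have hxT : ∀ T ∈ U.powerset, x ∉ T := fun T hT hx => hxU (mem_powerset.1 hT hx)
  have e1 : ∀ T ∈ U.powerset, insert x U \ T = insert x (U \ T) := by
    intro T hT; rw [Finset.insert_sdiff_of_notMem _ (hxT T hT)]
  have e2 : ∀ T ∈ U.powerset, insert x U \ insert x T = U \ T := by
    intro T hT
    rw [Finset.insert_sdiff_insert, Finset.sdiff_insert_of_notMem hxU]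
  have e3 : ∀ T : Finset α, insert x T ∪ C = T ∪ insert x C := by
    intro T; ext y; simp only [mem_union, mem_insert]; tauto
  -- expand everything as sums over `T ⊆ U`
  have hABF : (F.minorAB C (insert x U) : ℤ)
      = ∑ T ∈ U.powerset, ((if d T = 0 ∧ c (U \ T) = 4 then (1 : ℤ) else 0) + (if c T = 0 ∧ d (U \ T) = 4 then (1 : ℤ) else 0)) := by
    rw [F.minorAB_eq_sum, Finset.sum_powerset_insert hxU, ← Finset.sum_add_distrib]
    refine sum_congr rfl fun T hT => ?_
    rw [e1 T hT, e2 T hT, e3, e3]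
  have hCRF : (F.minorCR C (insert x U) : ℤ)
      = ∑ T ∈ U.powerset, ((if c (U \ T) ≠ 0 ∧ c (U \ T) ≠ 4 ∧ d T ≠ 0 ∧ d T ≠ 4 ∧ c (U \ T) < d T then (1 : ℤ) else 0)
          + (if d (U \ T) ≠ 0 ∧ d (U \ T) ≠ 4 ∧ c T ≠ 0 ∧ c T ≠ 4 ∧ d (U \ T) < c T then (1 : ℤ) else 0)) := by
    rw [F.minorCR_eq_sum, Finset.sum_powerset_insert hxU, ← Finset.sum_add_distrib]
    refine sum_congr rfl fun T hT => ?_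
    rw [e1 T hT, e2 T hT, e3, e3]
    simp only [hd, hc]
    congr 1
    · by_cases h : F.lab (T ∪ C) ≠ 0 ∧ F.lab (T ∪ C) ≠ 4 ∧ F.lab (U \ T ∪ insert x C) ≠ 0 ∧ F.lab (U \ T ∪ insert x C) ≠ 4 ∧
          F.lab (U \ T ∪ insert x C) < F.lab (T ∪ C)
      · rw [if_pos h, if_pos ⟨h.2.2.1, h.2.2.2.1, h.1, h.2.1, h.2.2.2.2⟩]
      · rw [if_neg h, if_neg fun h' => h ⟨h'.2.2.1, h'.2.2.2.1, h'.1, h'.2.1, h'.2.2.2.2⟩]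
    · by_cases h : F.lab (T ∪ insert x C) ≠ 0 ∧ F.lab (T ∪ insert x C) ≠ 4 ∧ F.lab (U \ T ∪ C) ≠ 0 ∧ F.lab (U \ T ∪ C) ≠ 4 ∧
          F.lab (U \ T ∪ C) < F.lab (T ∪ insert x C)
      · rw [if_pos h, if_pos ⟨h.2.2.1, h.2.2.2.1, h.1, h.2.1, h.2.2.2.2⟩]
      · rw [if_neg h, if_neg fun h' => h ⟨h'.2.2.1, h'.2.2.2.1, h'.1, h'.2.1, h'.2.2.2.2⟩]
  have hABd : (F.minorAB C U : ℤ) = ∑ T ∈ U.powerset, (if d T = 0 ∧ d (U \ T) = 4 then (1 : ℤ) else 0) := F.minorAB_eq_sum C U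
  have hABc : (F.minorAB (insert x C) U : ℤ) = ∑ T ∈ U.powerset, (if c T = 0 ∧ c (U \ T) = 4 then (1 : ℤ) else 0) :=
    F.minorAB_eq_sum (insert x C) U
  have hCRd : (F.minorCR C U : ℤ)
      = ∑ T ∈ U.powerset, (if d (U \ T) ≠ 0 ∧ d (U \ T) ≠ 4 ∧ d T ≠ 0 ∧ d T ≠ 4 ∧ d (U \ T) < d T then (1 : ℤ) else 0) := by
    rw [F.minorCR_eq_sum]
    refine sum_congr rfl fun T _ => ?_
    simp only [hd]
    by_cases h : F.lab (T ∪ C) ≠ 0 ∧ F.lab (T ∪ C) ≠ 4 ∧ F.lab (U \ T ∪ C) ≠ 0 ∧ F.lab (U \ T ∪ C) ≠ 4 ∧ F.lab (U \ T ∪ C) < F.lab (T ∪ C)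
    · rw [if_pos h, if_pos ⟨h.2.2.1, h.2.2.2.1, h.1, h.2.1, h.2.2.2.2⟩]
    · rw [if_neg h, if_neg fun h' => h ⟨h'.2.2.1, h'.2.2.2.1, h'.1, h'.2.1, h'.2.2.2.2⟩]
  have hCRc : (F.minorCR (insert x C) U : ℤ)
      = ∑ T ∈ U.powerset, (if c (U \ T) ≠ 0 ∧ c (U \ T) ≠ 4 ∧ c T ≠ 0 ∧ c T ≠ 4 ∧ c (U \ T) < c T then (1 : ℤ) else 0) := by
    rw [F.minorCR_eq_sum]
    refine sum_congr rfl fun T _ => ?_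
    simp only [hc]
    by_cases h : F.lab (T ∪ insert x C) ≠ 0 ∧ F.lab (T ∪ insert x C) ≠ 4 ∧ F.lab (U \ T ∪ insert x C) ≠ 0 ∧
        F.lab (U \ T ∪ insert x C) ≠ 4 ∧ F.lab (U \ T ∪ insert x C) < F.lab (T ∪ insert x C)
    · rw [if_pos h, if_pos ⟨h.2.2.1, h.2.2.2.1, h.1, h.2.1, h.2.2.2.2⟩]
    · rw [if_neg h, if_neg fun h' => h ⟨h'.2.2.1, h'.2.2.2.1, h'.1, h'.2.1, h'.2.2.2.2⟩]
  -- the difference is `Σ_T g(T)`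
  have hsum : ((F.minorAB C U : ℤ) - F.minorCR C U) + ((F.minorAB (insert x C) U : ℤ) - F.minorCR (insert x C) U)
      - ((F.minorAB C (insert x U) : ℤ) - F.minorCR C (insert x U))
      = ∑ T ∈ U.powerset, cubeG (d T) (c T) (d (U \ T)) (c (U \ T)) := by
    rw [hABF, hCRF, hABd, hABc, hCRd, hCRc]
    unfold cubeG
    simp only [← Finset.sum_sub_distrib, ← Finset.sum_add_distrib]
    refine sum_congr rfl fun T _ => ?_
    ring
  -- symmetrise: `2 Σ g = Σ (g(T) + g(U∖T)) ≤ 0`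
  have hsymm : (∑ T ∈ U.powerset, cubeG (d T) (c T) (d (U \ T)) (c (U \ T)))
      = ∑ T ∈ U.powerset, cubeG (d (U \ T)) (c (U \ T)) (d T) (c T) := by
    rw [← HallGladkov.sum_powerset_compl U (fun T => cubeG (d T) (c T) (d (U \ T)) (c (U \ T)))]
    refine sum_congr rfl fun T hT => ?_
    rw [Finset.sdiff_sdiff_eq_self (mem_powerset.1 hT)]
  have h2 : 2 * (∑ T ∈ U.powerset, cubeG (d T) (c T) (d (U \ T)) (c (U \ T))) ≤ 0 := by
    rw [two_mul]
    nth_rewrite 2 [hsymm]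
    rw [← Finset.sum_add_distrib]
    refine Finset.sum_nonpos fun T _ => ?_
    exact cubeG_symm_nonpos _ _ _ _ (F.lab_union_le T C x) (F.lab_union_le (U \ T) C x)
  have key : ((F.minorAB C U : ℤ) - F.minorCR C U) + ((F.minorAB (insert x C) U : ℤ) - F.minorCR (insert x C) U)
      - ((F.minorAB C (insert x U) : ℤ) - F.minorCR C (insert x U)) ≤ 0 := by
    rw [hsum]; linarith
  linarith

/-! ## (DC) at a dominant element -/

omit [Fintype α] in
/-- A minor all of whose labels are `4` has neither bottoms nor rainbows: `f(W; C) = 0` when `lab C = 4`. [this work] -/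
theorem minorSlack_eq_zero_of_top (W C : Finset α) (hC : F.lab C = 4) : F.minorSlack W C = 0 := by
  have hall : ∀ T : Finset α, F.lab (T ∪ C) = 4 := fun T => F.lab_eq_four_of_subset subset_union_right hC
  unfold minorSlack
  have hR : F.minorRainbows W C = 0 := by
    unfold minorRainbows
    rw [Finset.card_eq_zero, Finset.filter_eq_empty_iff]
    intro q _ h
    rw [hall] at h
    exact absurd h.1 (by decide)
  rw [hR, Finset.filter_false_of_mem (fun S _ => by rw [hall]; decide)]
  simp

omit [Fintype α] in
/-- **(DC) AT A DOMINANT ELEMENT** (this work): if `lab (C ∪ {x}) = 4` then `f(W∖x; C) + f(W∖x; C∪{x}) ≤ f(W; C)` — the typed conjecture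
`MinorSuperadditivity` holds at every dominant `x`. [this work] -/
theorem minorSuperadditivity_of_dominant (W C : Finset α) (x : α) (hx : x ∈ W) (hWC : Disjoint W C)
    (htop : F.lab (insert x C) = 4) :
    F.minorSlack (W.erase x) C + F.minorSlack (W.erase x) (insert x C) ≤ F.minorSlack W C := by
  have hxC : x ∉ C := fun h => (Finset.disjoint_left.1 hWC) hx h
  set W' := W.erase x with hW'
  have hxW' : x ∉ W' := Finset.notMem_erase x W
  have hWins : W = insert x W' := by rw [hW', Finset.insert_erase hx]
  rw [F.minorSlack_eq_zero_of_top W' (insert x C) htop, add_zero]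
  -- no rainbows in `(W;C)`: the block containing `x` would have label `4`
  have hall : ∀ T : Finset α, x ∈ T → F.lab (T ∪ C) = 4 := by
    intro T hxT
    exact F.lab_eq_four_of_subset (by
      intro y hy; rcases mem_insert.1 hy with rfl | h
      · exact mem_union_left _ hxT
      · exact mem_union_right _ h) htop
  have hRW : F.minorRainbows W C = 0 := by
    unfold minorRainbows
    rw [Finset.card_eq_zero, Finset.filter_eq_empty_iff]
    intro q hq h
    unfold partsOf at hq
    obtain ⟨hq12, hdisj⟩ := mem_filter.1 hq
    obtain ⟨h1W, h2W⟩ := mem_product.1 hq12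
    rw [mem_powerset] at h1W h2W
    by_cases hx1 : x ∈ q.1
    · rw [hall q.1 hx1] at h; exact absurd h.1 (by decide)
    by_cases hx2 : x ∈ q.2
    · rw [hall q.2 hx2] at h; exact absurd h.2.1 (by decide)
    · have hx3 : x ∈ W \ (q.1 ∪ q.2) := mem_sdiff.2 ⟨hx, by rw [mem_union, not_or]; exact ⟨hx1, hx2⟩⟩
      rw [hall _ hx3] at h; exact absurd h.2.2 (by decide)
  -- compare the bottom-spectator sums
  unfold minorSlack
  rw [hRW]
  have hbot : (W.powerset.filter (fun S => F.lab (S ∪ C) = 0)) = (W'.powerset.filter (fun S => F.lab (S ∪ C) = 0)) := by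
    ext S
    simp only [mem_filter, mem_powerset]
    constructor
    · rintro ⟨hSW, hS0⟩
      refine ⟨fun y hy => ?_, hS0⟩
      rw [hW', mem_erase]
      refine ⟨fun hyx => ?_, hSW hy⟩
      subst hyx
      rw [hall S hy] at hS0; exact absurd hS0 (by decide)
    · rintro ⟨hSW', hS0⟩
      exact ⟨hSW'.trans (Finset.erase_subset x W), hS0⟩
  rw [hbot]
  have hterm : ∀ S ∈ W'.powerset.filter (fun S => F.lab (S ∪ C) = 0),
      ((F.minorAB C (W' \ S) : ℤ) - F.minorCR C (W' \ S)) ≤ (F.minorAB C (W \ S) : ℤ) - F.minorCR C (W \ S) := by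
    intro S hS
    have hSW' : S ⊆ W' := mem_powerset.1 (mem_filter.1 hS).1
    have hxS : x ∉ S := fun h => hxW' (hSW' h)
    have hWS : W \ S = insert x (W' \ S) := by rw [hWins, Finset.insert_sdiff_of_notMem _ hxS]
    rw [hWS]
    have hcs := F.minorCube_superadditive C (W' \ S) x (fun h => hxW' (mem_sdiff.1 h).1)
    -- the contraction cube has slack `0 − 0`
    have hc0 : (F.minorAB (insert x C) (W' \ S) : ℤ) - F.minorCR (insert x C) (W' \ S) = 0 := by
      have hall' : ∀ T : Finset α, F.lab (T ∪ insert x C) = 4 := fun T => F.lab_eq_four_of_subset subset_union_right htop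
      have hA : F.minorAB (insert x C) (W' \ S) = 0 := by
        unfold minorAB; rw [Finset.card_eq_zero, Finset.filter_eq_empty_iff]
        intro O _ h; rw [hall'] at h; exact absurd h.1 (by decide)
      have hR : F.minorCR (insert x C) (W' \ S) = 0 := by
        unfold minorCR; rw [Finset.card_eq_zero, Finset.filter_eq_empty_iff]
        intro Y _ h; rw [hall' Y] at h; exact h.2.1 rfl
      rw [hA, hR]; simp
    linarith
  have hsum := Finset.sum_le_sum hterm
  have hRn : (0 : ℤ) ≤ (F.minorRainbows W' C : ℤ) := by exact_mod_cast Nat.zero_le _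
  push_cast
  linarith

end Sunflower

end Summit.CriticalPhenomena.PercolationContinuityZ3.Theorems.SunflowerPartition
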